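import Summits.Ventures.Crystal3D.Theorems.StickyWulffConstantCoaxialWallLawSeamSatCensusTwelveOneFreeDegree
import Summits.Ventures.Crystal3D.Theorems.StickyWulffConstantCoaxialWallLawStarSharing
import HarnessLib

/-!
# One-free-pair kissing configurations: at most TWO nodes have five contacts (hence at most 25 contact pairs)
# (crux `CoaxialWallLaw`, stmt-Ventures-19481; lane F stubs `stub_satCensus12Narrow` / `stub_satCensus12Glide` ⇐ C1 = `KissingClassificationOneFree (5/2)`;
#  sequel of '…SeamSatCensusTwelveOneFreeDegree', with '…StarSharing')

HONEST FRAMING. Venture `Summits/Ventures/Crystal3D` (cell `crystal3d-full`); helper `--supports` stmt-Ventures-19481, no stub closed.  '…OneFreeDegree' proved: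
in a one-free-pair `5/2`-configuration every node has `≤ 5` contacts, and `= 5` forces BOTH exempt points among the node's contacts.  Here the second
structural axiom a C1 growth search can use: the five-contact nodes are COMMON CONTACTS of the two exempt points, and two distinct points of `S²(2)` have at
most TWO common contacts (three spheres — `StarSharing.card_touching_three_le_two`, rescaled by `1/2`).  Hence
* `ncard_fiveNodes_le_two_of_oneFree` — at most two nodes have five (or more) contacts (if the exempt «pair» is degenerate, `a = b`, none has);
so the labelled fans of a one-free-pair search have node degrees `≤ 4` except at `≤ 2` labels of degree `5`, i.e. at most `25` contact pairs (FCC/HCP: `24`;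
the D₅ₕ two-ring dozen of '…TwoFreeRing', with TWO exempt pairs, has `23` contacts and two five-contact poles).
WHAT THIS IS NOT: C1 is NOT proved; no `SatCensus` piece is closed; F-C1 not moved.
-/

noncomputable section

namespace Summit.Ventures.Crystal3D.Theorems

namespace TailResidue

open Summit.Ventures.Crystal3D Finset

/-- **Two distinct points of `S²(2)` have at most two common contacts on `S²(2)`** (points at distance `2` from both): rescaling by `1/2`, three unit spheres
(about `0`, `a/2`, `b/2`) meet in at most two points (`StarSharing.card_touching_three_le_two`). [folklore] -/
theorem card_common_contacts_le_two {a b : EuclideanSpace ℝ (Fin 3)} (ha : ‖a‖ = 2) (hb : ‖b‖ = 2) (hab : a ≠ b) (T : Finset (EuclideanSpace ℝ (Fin 3)))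
    (hT : ∀ u ∈ T, ‖u‖ = 2 ∧ dist u a = 2 ∧ dist u b = 2) : T.card ≤ 2 := by
  classical
  have hinj : Function.Injective fun u : EuclideanSpace ℝ (Fin 3) => (1 / 2 : ℝ) • u := smul_right_injective _ (by norm_num)
  rw [← card_image_of_injective T hinj]
  have hq₁ : dist ((1 / 2 : ℝ) • a) 0 = 1 := by rw [dist_zero_right, norm_smul, ha]; norm_num
  have hq₂ : dist ((1 / 2 : ℝ) • b) 0 = 1 := by rw [dist_zero_right, norm_smul, hb]; norm_num
  have hne : (1 / 2 : ℝ) • a ≠ (1 / 2 : ℝ) • b := fun h => hab (hinj h)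
  refine StarSharing.card_touching_three_le_two hq₁ hq₂ hne _ fun p hp => ?_
  obtain ⟨u, hu, rfl⟩ := mem_image.1 hp
  obtain ⟨hu2, hua, hub⟩ := hT u hu
  refine ⟨?_, ?_, ?_⟩
  · rw [dist_zero_right, norm_smul, hu2]; norm_num
  · rw [dist_eq_norm, ← smul_sub, norm_smul, ← dist_eq_norm, hua]; norm_num
  · rw [dist_eq_norm, ← smul_sub, norm_smul, ← dist_eq_norm, hub]; norm_num

/-- **At most TWO five-contact nodes.**  In a one-free-pair `5/2`-configuration `S`, the set of nodes with at least five contacts has at most two elements.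
[cite: Hales2012, Lemma 7 (method)] -/
theorem ncard_fiveNodes_le_two_of_oneFree {S : Set (EuclideanSpace ℝ (Fin 3))} (hS : IsGapKissingConfigOneFree (5 / 2) S) :
    {v ∈ S | 5 ≤ {u ∈ S | dist u v = 2}.ncard}.ncard ≤ 2 := by
  classical
  have hfinS : S.Finite := hS.finite
  have hfin : {v ∈ S | 5 ≤ {u ∈ S | dist u v = 2}.ncard}.Finite := hfinS.subset fun v hv => hv.1
  obtain ⟨-, h12, -, a, b, hdich⟩ := hS
  -- contacts of a node, as a finset
  have hcont : ∀ v ∈ S, ∃ F : Finset (EuclideanSpace ℝ (Fin 3)), (∀ u, u ∈ F ↔ u ∈ S ∧ dist u v = 2) ∧ {u ∈ S | dist u v = 2}.ncard = F.card := by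
    intro v hv
    have hf : {u ∈ S | dist u v = 2}.Finite := hfinS.subset fun u hu => hu.1
    exact ⟨hf.toFinset, fun u => by rw [Set.Finite.mem_toFinset]; rfl, Set.ncard_eq_toFinset_card _ hf⟩
  by_cases hab : a = b
  · -- degenerate exemption: plain dichotomy, every node has ≤ 4 contacts, the set is empty
    subst hab
    have hempty : {v ∈ S | 5 ≤ {u ∈ S | dist u v = 2}.ncard} = ∅ := by
      ext v
      simp only [Set.mem_setOf_eq, Set.mem_empty_iff_false, iff_false, not_and, not_le]
      intro hv
      obtain ⟨F, hF, hc⟩ := hcont v hv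
      rw [hc]
      have h4 : F.card ≤ 4 := by
        refine Kissing125.card_le_four_of_neighbours25 (h12 v hv) (fun u hu => h12 u ((hF u).1 hu).1) (fun u hu => ((hF u).1 hu).2) fun u hu w hw hne => ?_
        rcases hdich u ((hF u).1 hu).1 w ((hF w).1 hw).1 with e | e | e | ⟨rfl, rfl⟩ | ⟨rfl, rfl⟩
        · exact absurd e hne
        · exact Or.inl e
        · exact Or.inr e
        · exact absurd rfl hne
        · exact absurd rfl hne
      omega
    rw [hempty, Set.ncard_empty]; norm_num
  · rw [Set.ncard_eq_toFinset_card _ hfin]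
    by_cases hne : hfin.toFinset = ∅
    · rw [hne]; simp
    obtain ⟨v₀, hv₀⟩ := Finset.nonempty_iff_ne_empty.2 hne
    have hmem : ∀ v ∈ hfin.toFinset, v ∈ S ∧ a ∈ S ∧ b ∈ S ∧ dist v a = 2 ∧ dist v b = 2 := by
      intro v hv
      obtain ⟨hvS, h5⟩ := (Set.Finite.mem_toFinset hfin).1 hv
      obtain ⟨F, hF, hc⟩ := hcont v hvS
      rw [hc] at h5
      obtain ⟨haF, hbF⟩ := card_contacts_le_four_of_oneFree h12 hdich hvS (fun u hu => ((hF u).1 hu).1) (fun u hu => ((hF u).1 hu).2) h5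
      exact ⟨hvS, ((hF a).1 haF).1, ((hF b).1 hbF).1, by rw [dist_comm]; exact ((hF a).1 haF).2, by rw [dist_comm]; exact ((hF b).1 hbF).2⟩
    obtain ⟨-, haS, hbS, -, -⟩ := hmem v₀ hv₀
    exact card_common_contacts_le_two (h12 a haS) (h12 b hbS) hab _ fun u hu => ⟨h12 u (hmem u hu).1, (hmem u hu).2.2.2.1, (hmem u hu).2.2.2.2⟩

end TailResidue

end Summit.Ventures.Crystal3D.Theorems

end
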